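import Literature.AnabelianGeometry.SemiGraphs.PSCSmoothCurveGenuineCuspidal
import HarnessLib

/-!
# The [CombGC] §1 datum-level predicates INSTANCED at the genuine pro-`ℓ` smooth curve of type `(g, r)`

Mochizuki, *A combinatorial version of the Grothendieck conjecture* [CombGC], Tohoku Math. J. **59**
(2007), §1: Def. 1.4 (iii)(iv) p. 10–11 (filtration-preserving, group-theoretically cuspidal), Prop. 1.2
(i)(ii) p. 8 and proof p. 9, Prop. 1.5 (i)(ii) p. 12–13, Thm. 1.6 (i)(iii) p. 13, Rmk. 1.1.3 / 1.1.5 p. 8;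
[IUTchI] Rmk. 1.2.3 (iv) p. 42. [cite: MochizukiCombGC2007, §1 pp.6-14]

PROOF-ONLY file (abc-iut cell, layer L3, [CombGC] non-vacuity programme; seat abc-iut-w5-d195 gen 7,
brick «SC-GENUINE-COVERING-CLOSED», part J).  The L3 lead's L-F table (`plan/L3/LF-SGA.tsv`, pack C)
asks, for the PREDICATE rows (PRED-NV: `GraphicIffEdgeLikeVerticial` F-0442, `IsEdgewiseFiltrationPreserving`
F-0446, `NumericallyCuspidalIffGroupTheoreticallyCuspidal` F-0457, `VerticialSeparatingCoverings` F-2826,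
`EdgeLikeSeparatingCoverings` F-2827, `UnrVerticialSeparatingCoverings` F-2828, `SeparatingCoverings`
F-2829, …) and the THEOREM rows (`…Holds`), for an instance AT THE GENUINE CARRIER.  This file reads them
off the pro-`ℓ` genuine smooth-curve origin (`exists_smoothCurveGenuineProLOrigin_holds`): for every prime
`ℓ` and every hyperbolic `(g, r)` there is the genuine datum `G` of the pro-`ℓ` smooth curve of type `(g, r)`
(one vertex `Π_v = Π = ` the pro-`ℓ` completion of `Γ_{g,r}`, genus `g`, `r` cusps `closure ι⟨c_j⟩`) AT
WHICH all of the following hold (`exists_genuine_proL_smoothCurve_instances`):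
`NumericallyCuspidalIffGroupTheoreticallyCuspidal G G id` (Thm. 1.6 (i)), `GraphicIffEdgeLikeVerticial G G id`
(Prop. 1.5 (ii)), `IsVerticially/EdgewiseFiltrationPreserving G G id` (Def. 1.4 (iii)),
`UnrVerticiallyFiltrationPreservingIffVerticial G G id` (Thm. 1.6 (iii)), `SeparatingCoverings` and its
three conjuncts (Prop. 1.2 proof), `VerticialEdgeLikeCommensurablyTerminal ∧ UnrVerticialCommensurablyTerminal`
(Prop. 1.2 (ii)), the three `…OpenInterDetermines…` (Prop. 1.2 (i)), `EdgeLikeIncidence` (Prop. 1.5 (i)),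
`CuspidalEdgeLikeCharacterization`, `UnrVerticialSplitInjection'`, `ElementaryQuotientVerticiallyRamifiedIff`,
`VertexQuotientCharacterization ∧ VertexSetCharacterization` ([IUTchI] Rmk. 1.2.3 (iv)), `UnrVertAbOfRank`,
`SturdyAtTopIffSturdy ∧ SturdyCharacteristicCover` (Rmk. 1.1.5), `VertCountLeNodeCountSucc` (Rmk. 1.1.3).
Instances at genuine data (for `r ≥ 2` every cusp quantifier is non-vacuous); not the printed theorems
for all pointed stable curves; 0 definitions; nothing here takes a side on [IUTchIII] Cor. 3.12.
-/

noncomputable section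

namespace Literature.AnabelianGeometry.SemiGraphs

namespace PSCDatum

open scoped Pointwise
open Literature.GroupTheory.CombinatorialGroupTheory
open Literature.GroupTheory.CombinatorialGroupTheory.PuncturedSurfaceGroup (cuspInertia IsHyperbolicType)
open SemiGraphOfAnabelioids (IsProSigmaCompletion)

/-- **The genuine pro-`ℓ` smooth curve of type `(g, r)` instances the [CombGC] §1 / [IUTchI] Rmk. 1.2.3
predicates.**  For every prime `ℓ` and hyperbolic `(g, r)` there are a profinite `Π` (a pro-`ℓ` completion
`ι : Γ_{g,r} → Π`) and the PSC datum `G` of the smooth curve of type `(g, r)` over it (`Σ = {ℓ}`, one vertex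
`Π_v = Π` of genus `g`, no nodes, `r` cusps `closure ι⟨c_j⟩`) at which — with `α = id_Π` for the
two-datum predicates — Thm. 1.6 (i), Prop. 1.5 (ii), Def. 1.4 (iii) (both filtrations), Thm. 1.6 (iii),
Prop. 1.2 (proof: separating coverings; (i); (ii)), Prop. 1.5 (i), [IUTchI] Rmk. 1.2.3 (iv) (cuspidal and
verticial parts, vertex-set characterization), Rmk. 1.1.5 (rank `2g`, sturdy iff genus `≥ 2`, sturdy
characteristic cover) and Rmk. 1.1.3 (`i ≤ n + 1` at every covering) all HOLD as typed.
[cite: MochizukiCombGC2007, §1 pp.6-14] -/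
theorem exists_genuine_proL_smoothCurve_instances (ℓ : ℕ) (hℓ : ℓ.Prime) (g r : ℕ)
    (hgr : IsHyperbolicType g r) :
    ∃ (Q : ProfiniteGrp.{0}) (ι : PuncturedSurfaceGroup g r →* Q) (G : PSCDatum Q),
      IsProSigmaCompletion {ℓ} ι ∧ G.Sigma = {ℓ} ∧ G.graph.i = 1 ∧ G.graph.n = 0 ∧ G.graph.r = r ∧
      (∀ v, G.vertGp v = ⊤ ∧ G.genus v = g) ∧
      (∃ e : G.graph.C ≃ Fin r, ∀ c, G.cuspGp c = ((cuspInertia (g := g) (e c)).map ι).topologicalClosure) ∧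
      -- two-datum predicates at `α = id`
      G.NumericallyCuspidalIffGroupTheoreticallyCuspidal G (ContinuousMulEquiv.refl Q) ∧
      G.GraphicIffEdgeLikeVerticial G (ContinuousMulEquiv.refl Q) ∧
      G.IsVerticiallyFiltrationPreserving G (ContinuousMulEquiv.refl Q) ∧
      G.IsEdgewiseFiltrationPreserving G (ContinuousMulEquiv.refl Q) ∧
      G.UnrVerticiallyFiltrationPreservingIffVerticial G (ContinuousMulEquiv.refl (Q ⧸ G.unrKer)) ∧
      -- Prop. 1.2 proof / (ii) / (i), Prop. 1.5 (i)
      G.SeparatingCoverings ∧ G.VerticialSeparatingCoverings ∧ G.EdgeLikeSeparatingCoverings ∧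
      G.UnrVerticialSeparatingCoverings ∧
      G.VerticialEdgeLikeCommensurablyTerminal ∧ G.UnrVerticialCommensurablyTerminal ∧
      G.VerticialOpenInterDeterminesVertex ∧ G.EdgeLikeOpenInterDeterminesEdge ∧
      G.UnrVerticialOpenInterDeterminesVertex ∧ G.EdgeLikeIncidence ∧
      -- [IUTchI] Rmk. 1.2.3 (iv), Rmk. 1.1.5, Rmk. 1.1.3
      G.CuspidalEdgeLikeCharacterization ∧ G.UnrVerticialSplitInjection' ∧
      G.ElementaryQuotientVerticiallyRamifiedIff ∧ G.VertexQuotientCharacterization ∧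
      G.VertexSetCharacterization ∧ G.UnrVertAbOfRank ∧ G.SturdyAtTopIffSturdy ∧
      G.SturdyCharacteristicCover ∧ G.VertCountLeNodeCountSucc := by
  obtain ⟨Ω, hinh, -, -, hsturdy, hrank, hunr, hconn, hvset, hsep, hct, hopen, hinc, hunrIff, hgraphic,
    hcusp, hnum⟩ := exists_smoothCurveGenuineProLOrigin_holds ℓ hℓ
  obtain ⟨Q, ι, G, hι, hG, hS, hi, hn, hr, hvg, he⟩ := hinh g r hgr
  have hid : (ContinuousMulEquiv.refl Q).toMulEquiv.toMonoidHom = MonoidHom.id Q := rfl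
  refine ⟨Q, ι, G, hι, hS, hi, hn, hr, hvg, he, hnum G G _ hG hG, hgraphic G G _ hG hG, ?_, ?_,
    hunrIff G G _ hG hG, hsep G hG, (hsep G hG).1, (hsep G hG).2.1, (hsep G hG).2.2, (hct G hG).1,
    (hct G hG).2, (hopen G hG).1, (hopen G hG).2.1, (hopen G hG).2.2, hinc G hG, hcusp G hG,
    (hunr G hG).1, (hunr G hG).2, (hvset G hG).1, (hvset G hG).2, hrank G hG, (hsturdy G hG).1,
    (hsturdy G hG).2, hconn G hG⟩
  · intro U _
    rw [hid, Subgroup.map_id, Subgroup.map_id]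
  · intro U _
    rw [hid, Subgroup.map_id, Subgroup.map_id]

end PSCDatum

end Literature.AnabelianGeometry.SemiGraphs

end
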